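import Literature.AlgebraicGeometry.HodgeTheory.HodgeRiemannDegreeOneProofs
import Literature.AlgebraicGeometry.HodgeTheory.DegreeOneHodgeTypes
import HarnessLib

/-!
# The Hodge–Riemann signs in degree one: positive on `H^{1,0}`, negative on `H^{0,1}`

Family `hodge`, layer `Literature/AlgebraicGeometry/HodgeTheory`. Theorems only; no definition and no
named fact is introduced.

For `X ⊂ ℙᴺ` smooth projective over `ℂ` of dimension `d + 1`, `h = ι^* a` the pull-back of a non-zero
rational class `a ∈ H²(ℙᴺ(ℂ); ℂ)`, and the polarization pairing
`Q_{h,d}(x, y) = hᵈ ⌣ (x ⌣ y) ∈ H^{2+2d}(X(ℂ); ℂ)` on `H¹(X(ℂ); ℂ)`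
(`Motives.polarizationPairingOne`), the Hodge–Riemann bilinear relation in degree one
(C. Voisin, *Hodge Theory and Complex Algebraic Geometry I*, Thm. 6.32 at `k = 1`) says that the
Hermitian form `(x, y) ↦ i · Q_{h,d}(x, ȳ)` is DEFINITE on each of the two Hodge pieces of
`H¹ = H^{1,0} ⊕ H^{0,1}`, with OPPOSITE signs (the sign `i^{p-q}` is `i` on `(1,0)` and `-i` on
`(0,1)`). We record this as a class identity relative to ONE non-zero rational top class `ω₀`:

* `hodgeRiemann_degreeOne_signs` — there is a rational `ω₀ ≠ 0` in `H^{2+2d}(X(ℂ); ℂ)` with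
  `i · Q_{h,d}(x, x̄) = t · ω₀`, `t > 0`, for every non-zero `x` of type `(1,0)`, and
  `i · Q_{h,d}(y, ȳ) = t · ω₀`, `t < 0`, for every non-zero `y` of type `(0,1)`.

  The `(1,0)` half (with `ω₀`) is verbatim the tree's `hodgeRiemann_degreeOne_of_isOfHodgeType`
  (file `HodgeRiemannDegreeOneProofs`). The `(0,1)` half follows from it: for `y` of type `(0,1)`
  the conjugate `ȳ` is a non-zero class of type `(1,0)` (conjugation swaps the Hodge pieces,
  Voisin I Cor. 6.12, `IsOfHodgeType.conjClass`), so `i · Q(ȳ, y) = t · ω₀` with `t > 0`; and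
  `Q(y, ȳ) = -Q(ȳ, y)` because the cup product of two degree-one classes is anticommutative
  (Hatcher, Thm. 3.11, `cupProduct_gradedComm_holds`) and `Q_{h,d}` is linear in the cup product.
  This is the sign computation behind the signature `(n, n)` of the Hermitian form of a polarized
  abelian variety of Weil type (B. van Geemen, LNM 1594, Lemma 5.2 (4)–(5)).

* `im_eq_zero_of_smul_eq_of_conjClass_eq` — two REAL classes (`conj u = u`, `conj v = v`, `v ≠ 0`)
  that are complex proportional, `u = c · v`, are so by a REAL scalar: `Im c = 0` (apply
  conjugation, which is conjugate-linear: `(c̄ - c) · v = 0`).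

## References

* [VoisinHodgeI2002] C. Voisin, Hodge Theory and Complex Algebraic Geometry I (CUP 2002), §6.1.3
  Cor. 6.12, §6.3.2 Thm. 6.32, §7.1.2.
* [vanGeemen1994HodgeAV] B. van Geemen, An introduction to the Hodge conjecture for abelian
  varieties, LNM 1594 (1994), Lemma 5.2 (4)–(5).
* [HatcherAT2002] A. Hatcher, Algebraic Topology (CUP 2002), Thm. 3.11.
-/

noncomputable section

open scoped ComplexConjugate
open CategoryTheory AlgebraicGeometry
open Literature.AlgebraicTopology.SingularHomology

namespace Literature.AlgebraicGeometry.HodgeTheory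

section HodgeTheory

/-- **Hodge–Riemann in degree one, both signs.** For `X ⊂ ℙᴺ` smooth projective of dimension
`d + 1` and `h = ι^* a` the pull-back of a non-zero rational class of `H²(ℙᴺ(ℂ); ℂ)`, there is a
non-zero RATIONAL top class `ω₀ ∈ H^{2+2d}(X(ℂ); ℂ)` such that `i · hᵈ ⌣ (x ⌣ x̄) = t · ω₀` with
`t > 0` for every non-zero class `x` of type `(1,0)`, and with `t < 0` for every non-zero class of
type `(0,1)` (Voisin I, Thm. 6.32 at `k = 1`: the form `i^{p-q} Q(x, x̄)` is positive on the —
automatically primitive — pieces `H^{1,0}`, `H^{0,1}`, and `i^{p-q} = -i` on `(0,1)`; equivalently,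
`Q(y, ȳ) = -Q(ȳ, y)` by anticommutativity of the cup product in degree one, with `ȳ` of type
`(1,0)`). The sign input of van Geemen's signature computation, LNM 1594, Lemma 5.2 (4)–(5).
[cite: VoisinHodgeI2002, §6.3.2 Thm. 6.32 and §6.1.3 Cor. 6.12] -/
theorem hodgeRiemann_degreeOne_signs {d : ℕ} {X : Motives.SchemeOver ℂ}
    (hX : Motives.IsSmoothProjective (d + 1) X) (emb : Motives.ProjectiveEmbedding X)
    {a : complexBetti (Motives.projectiveSpace emb.n ℂ) 2} (ha : IsRationalClass a) (ha0 : a ≠ 0) :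
    ∃ ω₀ : complexBetti X (2 + 2 * d), IsRationalClass ω₀ ∧ ω₀ ≠ 0 ∧
      (∀ x : complexBetti X 1, IsOfHodgeType (d + 1) X 1 1 0 x → x ≠ 0 →
        ∃ t : ℝ, 0 < t ∧
          Complex.I • Motives.polarizationPairingOne X (complexBetti.map emb.ι 2 a) d x
            (conjClass (Motives.ComplexPoints X) 1 x) = (t : ℂ) • ω₀) ∧
      (∀ y : complexBetti X 1, IsOfHodgeType (d + 1) X 1 0 1 y → y ≠ 0 →
        ∃ t : ℝ, t < 0 ∧
          Complex.I • Motives.polarizationPairingOne X (complexBetti.map emb.ι 2 a) d y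
            (conjClass (Motives.ComplexPoints X) 1 y) = (t : ℂ) • ω₀) := by
  obtain ⟨ω₀, h1, h2, h3⟩ := hodgeRiemann_degreeOne_of_isOfHodgeType hX emb ha ha0
  refine ⟨ω₀, h1, h2, h3, fun y hy hy0 ↦ ?_⟩
  -- `ȳ` is a non-zero class of type `(1,0)`
  have hyb : IsOfHodgeType (d + 1) X 1 1 0 (conjClass (Motives.ComplexPoints X) 1 y) :=
    hy.conjClass hX
  have hyb0 : conjClass (Motives.ComplexPoints X) 1 y ≠ 0 := fun h ↦ hy0 (by
    rw [← conjClass_conjClass y, h, conjClass_zero])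
  obtain ⟨t, ht, hid⟩ := h3 _ hyb hyb0
  rw [conjClass_conjClass] at hid
  refine ⟨-t, neg_lt_zero.2 ht, ?_⟩
  -- `Q(y, ȳ) = -Q(ȳ, y)`: the cup product is anticommutative in degree one
  have hanti : Motives.polarizationPairingOne X (complexBetti.map emb.ι 2 a) d y
        (conjClass (Motives.ComplexPoints X) 1 y) =
      -Motives.polarizationPairingOne X (complexBetti.map emb.ι 2 a) d
        (conjClass (Motives.ComplexPoints X) 1 y) y := by
    rw [Motives.polarizationPairingOne_apply, Motives.polarizationPairingOne_apply,
      cupProduct_gradedComm_holds ℂ (Motives.ComplexPoints X) rfl rfl y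
        (conjClass (Motives.ComplexPoints X) 1 y), map_smul, mul_one, pow_one, neg_one_smul]
  rw [hanti, smul_neg, hid, Complex.ofReal_neg, neg_smul]

/-- **Real classes differ by real scalars**: if `u = c · v` in `Hᵏ(Y; ℂ)` with `u`, `v` invariant
under complex conjugation of coefficients and `v ≠ 0`, then `c` is real (`Im c = 0`): conjugating,
`u = c̄ · v`, so `(c̄ - c) · v = 0`. [folklore] -/
theorem im_eq_zero_of_smul_eq_of_conjClass_eq {Y : Type} [TopologicalSpace Y] {k : ℕ}
    {u v : singularCohomology ℂ ℂ Y k} (hu : conjClass Y k u = u) (hv : conjClass Y k v = v)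
    (hv0 : v ≠ 0) {c : ℂ} (h : u = c • v) : c.im = 0 := by
  have h1 : c • v = starRingEnd ℂ c • v := by
    have h' := congrArg (conjClass Y k) h
    rwa [hu, conjClass_smul, hv, h] at h'
  have h2 : (starRingEnd ℂ c - c) • v = 0 := by rw [sub_smul, ← h1, sub_self]
  rcases smul_eq_zero.1 h2 with h3 | h3
  · exact Complex.conj_eq_iff_im.1 (sub_eq_zero.1 h3)
  · exact absurd h3 hv0

end HodgeTheory

end Literature.AlgebraicGeometry.HodgeTheory

end
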